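import Mathlib
import Summits.Ventures.PercRepro2.TypedBHKIndepSrc

/-!
# Typed BHK 1.4 single-vertex on the INDEPENDENT CLASS — III: the clusters of `a₂` after `Φ`
(p5 g3, 2026-08-25; file 3 of 4). `not_conn_Φ_a2_o` (item 5: the first-copy cluster of `a₂` after
`Φ` is `a₂` plus unflipped pendants, so it contains neither `o` nor `a₁`) and
`not_conn_flipOn_Φ_a1_a2` (item 7: the second-copy cluster of `a₂` after `Φ` lies in
`T″ ∪ {o} ∪ Fl₂ ∪ Fl₃ ∪ Pend_o`, none of which contains `a₁`).
-/

namespace Summit.Ventures.PercRepro2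

namespace TypedBHKIndep

open CovForm A3InactiveTyped TB14Fold

section Clusters

variable {V : Type} {E : Type} [Fintype E] [DecidableEq E] [DecidableEq V]
variable (ends : E → Sym2 V) (a₁ a₂ b o : V) (F : Finset E)

omit [Fintype E] in
/-- (item 5) after `Φ`, the first-copy cluster of `a₂` contains neither `o` nor `a₁`: it consists
of `a₂` and unflipped unmarked vertices all of whose `y`-open edges go to `a₂`. -/
lemma not_conn_Φ_a2_o (hF : ∀ e, e ∈ F) (hcls : IndepClass ends a₁ a₂ b o) {y : Config E}
    (hs : IsSource ends a₁ a₂ b o F y) :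
    ¬ Conn ends (Φ ends a₁ a₂ b o F y) a₂ o ∧ ¬ Conn ends (Φ ends a₁ a₂ b o F y) a₁ a₂ := by
  let Z : Set V := {v | v = a₂ ∨ (v ∉ marks a₁ a₂ b o ∧ ¬ sharesColourAtO ends o y v ∧
    ∀ f, y f = true → v ∈ ends f → a₂ ∈ ends f)}
  have hclosed : ∀ x ∈ Z, ∀ w, (openGraph ends (Φ ends a₁ a₂ b o F y)).Adj x w → w ∈ Z := by
    rintro x hx w hadj
    rw [openGraph_adj] at hadj
    obtain ⟨hxw, e, hΦe, hends⟩ := hadj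
    have hxe : x ∈ ends e := by rw [hends]; simp
    have hwe : w ∈ ends e := by rw [hends]; simp
    rcases hx with hxa | ⟨hxm, hxns, hxall⟩
    · -- x = a₂
      subst x
      rcases Φ_open_cases ends a₁ a₂ b o F hF hΦe with ⟨hye, hnf⟩ | ⟨hye, hf⟩
      · -- y-open unflipped edge at a₂: w ∈ T, w ≠ a₁, b; w = o impossible (flipped); w unmarked
        have hwT : Conn ends y a₂ w := conn_of_openAdj ⟨e, hye, hends⟩
        by_cases hwm : w ∈ marks a₁ a₂ b o
        · rcases src_mark_mem_T ends a₁ a₂ b o F hs hwT hwm with h | h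
          · exact Or.inl h
          · subst h
            exfalso; apply hnf; left
            refine ⟨hwe, fun v hv => ?_⟩
            rw [hends] at hv
            rcases Sym2.mem_iff.1 hv with rfl | rfl
            · exact mem_marks.2 (Or.inr (Or.inl rfl))
            · exact mem_marks.2 (Or.inr (Or.inr (Or.inr rfl)))
        · right
          refine ⟨hwm, fun hsh => hnf (Or.inr ⟨w, hwe, hwm, hsh⟩), fun f hyf hwf => ?_⟩
          -- every y-open edge at w goes to a₂ or o; to o would make w flipped
          obtain ⟨v, hv⟩ := Sym2.mem_iff_exists.1 hwf
          have hvw : v ≠ w := by intro hvw; rw [hvw] at hv; exact (hcls f w hwf hwm).2.1 hv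
          have hvm : v ∈ marks a₁ a₂ b o := (hcls f w hwf hwm).1 v (by rw [hv]; simp) hvw
          have hvT : Conn ends y a₂ v := conn_trans hwT (conn_of_openAdj ⟨f, hyf, hv⟩)
          rcases src_mark_mem_T ends a₁ a₂ b o F hs hvT hvm with h | h
          · rw [hv, h]; simp
          · rw [h] at hv
            exfalso; apply hnf; right
            exact ⟨w, hwe, hwm, src_shares_of_two ends a₁ a₂ b o F hs hwm hye
              (by rw [hends, Sym2.eq_swap]) hyf hv⟩
      · -- y-closed flipped edge at a₂: impossible in a source
        exfalso
        rcases hf with h | ⟨u, hue, hum, hsh⟩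
        · -- e = a₂–o closed in y: o ∈ T′
          have hoe := h.1; rw [hends] at hoe
          rcases Sym2.mem_iff.1 hoe with h' | h'
          · exact (src_o_ne_a2 ends a₁ a₂ b o F hs) h'
          · subst h'
            exact hs.ho' (conn_of_openAdj ⟨e, by unfold flipOn; rw [if_pos (hF e), hye]; rfl, hends⟩)
        · -- e = u–a₂ closed at a flipped u
          have huw : u = w := by
            rw [hends] at hue
            rcases Sym2.mem_iff.1 hue with h' | h'
            · exact absurd (h' ▸ mem_marks.2 (Or.inr (Or.inl rfl))) hum
            · exact h'
          subst huw
          obtain ⟨e₀, hue₀, hoe₀, e₁, hue₁, hne, hcol⟩ := hsh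
          obtain ⟨hmk₀, hl₀, hsg₀⟩ := hcls e₀ u hue₀ hum
          have hends₀ : ends e₀ = s(u, o) := by
            obtain ⟨v, hv⟩ := Sym2.mem_iff_exists.1 hue₀
            rw [hv] at hoe₀ ⊢
            rcases Sym2.mem_iff.1 hoe₀ with h' | h'
            · exact absurd (h'.symm ▸ mem_marks.2 (Or.inr (Or.inr (Or.inr rfl)))) hum
            · rw [h']
          by_cases hc : y e₀ = true
          · -- u–o open: u ∈ T; its other open edge e₁ goes to a mark of T other than o and a₂ — none
            obtain ⟨w₁, hw₁⟩ := Sym2.mem_iff_exists.1 hue₁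
            have hw₁u : w₁ ≠ u := by intro hwu; rw [hwu] at hw₁; exact (hcls e₁ u hue₁ hum).2.1 hw₁
            have hw₁m : w₁ ∈ marks a₁ a₂ b o := (hcls e₁ u hue₁ hum).1 w₁ (by rw [hw₁]; simp) hw₁u
            have hye₁ : y e₁ = true := by rw [hcol, hc]
            have huT : Conn ends y a₂ u := conn_trans hs.ho (conn_of_openAdj ⟨e₀, hc, by rw [hends₀, Sym2.eq_swap]⟩)
            have hw₁T : Conn ends y a₂ w₁ := conn_trans huT (conn_of_openAdj ⟨e₁, hye₁, hw₁⟩)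
            rcases src_mark_mem_T ends a₁ a₂ b o F hs hw₁T hw₁m with h' | h'
            · -- w₁ = a₂: e₁ has the ends of e, so e₁ = e, but e is closed
              subst h'
              have := (hcls e u hue hum).2.2 e₁ (by rw [hw₁, hends, Sym2.eq_swap])
              subst this; rw [hye] at hye₁; exact Bool.noConfusion hye₁
            · subst h'
              exact hne (hsg₀ e₁ (by rw [hw₁, hends₀]))
          · -- u–o closed and u–a₂ closed: o ∈ T′ through u
            have hc₀ : y e₀ = false := by simpa using hc
            exact hs.ho' (conn_trans
              (conn_of_openAdj ⟨e, by unfold flipOn; rw [if_pos (hF e), hye]; rfl, hends⟩)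
              (conn_of_openAdj ⟨e₀, by unfold flipOn; rw [if_pos (hF e₀), hc₀]; rfl, hends₀⟩))
    · -- x an unflipped pendant at a₂: its Φ-open edges are its y-open edges, all to a₂
      rcases Φ_open_cases ends a₁ a₂ b o F hF hΦe with ⟨hye, -⟩ | ⟨-, hf⟩
      · have := hxall e hye hxe
        rw [hends] at this
        rcases Sym2.mem_iff.1 this with h | h
        · exact absurd (h ▸ mem_marks.2 (Or.inr (Or.inl rfl))) hxm
        · exact Or.inl h.symm
      · exfalso
        rcases hf with h | ⟨u, hue, hum, hsh⟩
        · exact hxm (h.2 x hxe)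
        · by_cases hux : u = x
          · subst hux; exact hxns hsh
          · exact hum ((hcls e x hxe hxm).1 u hue hux)
  have ha₂Z : a₂ ∈ Z := Or.inl rfl
  constructor
  · intro h
    rcases mem_of_conn_of_closed hclosed ha₂Z h with h' | ⟨h', -⟩
    · exact (src_o_ne_a2 ends a₁ a₂ b o F hs) h'
    · exact h' (mem_marks.2 (Or.inr (Or.inr (Or.inr rfl))))
  · intro h
    rcases mem_of_conn_of_closed hclosed ha₂Z (conn_symm h) with h' | ⟨h', -⟩
    · exact hs.q₁ (h' ▸ conn_refl _ _ _)
    · exact h' (mem_marks.2 (Or.inl rfl))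

omit [Fintype E] in
/-- (item 7) `a₁ ↮ a₂` in the second copy after `Φ`: the second-copy cluster of `a₂` lies in
`Z = T″ ∪ {o} ∪ Fl₂ ∪ Fl₃ ∪ Pend_o`, where `T″` is the cluster of `a₂` in the closed-unflipped
configuration, `Fl₂` the flipped vertices with an open edge to `a₂` or `o`, `Fl₃` the flipped
vertices with an open edge to `b ∈ T″`, `Pend_o` the unflipped vertices with a closed edge to
`o`; `a₁` is in none of these. -/
lemma not_conn_flipOn_Φ_a1_a2 (hF : ∀ e, e ∈ F) (hcls : IndepClass ends a₁ a₂ b o)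
    {y : Config E} (hs : IsSource ends a₁ a₂ b o F y) :
    ¬ Conn ends (flipOn F (Φ ends a₁ a₂ b o F y)) a₁ a₂ := by
  intro hcon
  set c := cuf ends a₁ a₂ b o F y with hc
  let Z : Set V := {v | Conn ends c a₂ v ∨ v = o ∨
    (v ∉ marks a₁ a₂ b o ∧ sharesColourAtO ends o y v ∧
      ∃ f, y f = true ∧ v ∈ ends f ∧ (a₂ ∈ ends f ∨ o ∈ ends f)) ∨
    (v ∉ marks a₁ a₂ b o ∧ sharesColourAtO ends o y v ∧ Conn ends c a₂ b ∧
      ∃ f, y f = true ∧ v ∈ ends f ∧ b ∈ ends f) ∨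
    (v ∉ marks a₁ a₂ b o ∧ ¬ sharesColourAtO ends o y v ∧ ∃ f, y f = false ∧ ends f = s(v, o))}
  have hcle : c ≤ flipOn F y := cuf_le ends a₁ a₂ b o F y
  have ha₂Z : a₂ ∈ Z := Or.inl (conn_refl _ _ _)
  -- a₁ ∉ Z
  have ha₁Z : a₁ ∉ Z := by
    rintro (h | h | ⟨h, -⟩ | ⟨h, -⟩ | ⟨h, -⟩)
    · exact hs.q₂ (conn_symm (conn_mono hcle h))
    · exact src_ne_a1 ends a₁ a₂ b o F hs hs.ho h.symm
    all_goals exact h (mem_marks.2 (Or.inl rfl))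
  -- closure of Z under second-copy-of-Φ adjacency
  have hclosed : ∀ x ∈ Z, ∀ w, (openGraph ends (flipOn F (Φ ends a₁ a₂ b o F y))).Adj x w → w ∈ Z := by
    rintro x hx w hadj
    rw [openGraph_adj] at hadj
    obtain ⟨hxw, e, h2e, hends⟩ := hadj
    have hxe : x ∈ ends e := by rw [hends]; simp
    have hwe : w ∈ ends e := by rw [hends]; simp
    rcases open2_cases ends a₁ a₂ b o F hF h2e with ⟨hye, hf⟩ | ⟨hye, hnf⟩
    · -- y-open flipped edge
      rcases hf with hmk | ⟨u, hue, hum, hsh⟩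
      · -- mark–mark edge at o: {x, w} = {a₂, o} (the other open mark–mark edges at o are excluded)
        have hoe := hmk.1
        rw [hends] at hoe
        have key : ∀ v, v ∈ ends e → v = o ∨ v = a₂ := by
          intro v hv
          have hvm : v ∈ marks a₁ a₂ b o := hmk.2 v hv
          by_cases hvo : v = o
          · exact Or.inl hvo
          · right
            have hvT : Conn ends y a₂ v := by
              have : OpenAdj ends y o v := by
                rcases Sym2.mem_iff.1 hoe with h | h
                · refine ⟨e, hye, ?_⟩
                  rw [hends, ← h]
                  rw [hends] at hv
                  rcases Sym2.mem_iff.1 hv with h' | h'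
                  · exact absurd (h'.trans h.symm) hvo
                  · rw [h']
                · refine ⟨e, hye, ?_⟩
                  rw [hends, ← h, Sym2.eq_swap]
                  rw [hends] at hv
                  rcases Sym2.mem_iff.1 hv with h' | h'
                  · rw [h']
                  · exact absurd (h'.trans h.symm) hvo
              exact conn_trans hs.ho (conn_of_openAdj this)
            rcases src_mark_mem_T ends a₁ a₂ b o F hs hvT hvm with h | h
            · exact h
            · exact absurd h hvo
        rcases key w hwe with h | h
        · exact Or.inr (Or.inl h)
        · rw [h]; exact ha₂Z
      · -- an edge at the flipped unmarked u ∈ {x, w}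
        by_cases huw : u = w
        · -- w is flipped; x is a mark (the class); x ∈ Z ∩ marks ⊆ {a₂, o, b}
          subst u
          have hxm : x ∈ marks a₁ a₂ b o := (hcls e w hwe hum).1 x hxe hxw
          rcases hx with hxc | hxo | ⟨hxm', -⟩ | ⟨hxm', -⟩ | ⟨hxm', -⟩
          · -- x ∈ T″ ∩ marks: x = a₂ or x = b (not a₁: q₂; not o: ho')
            rcases mem_marks.1 hxm with h | h | h | h
            · exact absurd (conn_symm (conn_mono hcle (h ▸ hxc))) hs.q₂
            · subst h
              exact Or.inr (Or.inr (Or.inl ⟨hum, hsh, e, hye, hwe, Or.inl hxe⟩))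
            · subst h
              exact Or.inr (Or.inr (Or.inr (Or.inl ⟨hum, hsh, hxc, e, hye, hwe, hxe⟩)))
            · subst h
              exact absurd (conn_mono hcle hxc) hs.ho'
          · subst x
            exact Or.inr (Or.inr (Or.inl ⟨hum, hsh, e, hye, hwe, Or.inr hxe⟩))
          all_goals exact absurd hxm hxm'
        · -- u = x is flipped with an open edge e to the mark w: w ∈ {a₂, o} or w = b with ...
          have hux : u = x := by
            rw [hends] at hue
            rcases Sym2.mem_iff.1 hue with h | h
            · exact h
            · exact absurd h huw
          subst u
          rcases hx with hxc | hxo | ⟨-, -, f, hyf, huf, hf2⟩ | ⟨-, -, hbc, f, hyf, huf, hbf⟩ | ⟨-, hns, -⟩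
          · -- a flipped vertex is isolated in c, hence not in T″ (unless it is a₂, which is marked)
            exfalso
            -- every edge at x is flipped, so c vanishes on it: the cluster of a₂ in c cannot contain x
            have hiso : ∀ v, (openGraph ends c).Adj x v → False := by
              intro v hv
              rw [openGraph_adj] at hv
              obtain ⟨-, g, hcg, hg⟩ := hv
              rw [cuf_eq_true_iff] at hcg
              exact hcg.1 (Or.inr ⟨x, by rw [hg]; simp, hum, hsh⟩)
            -- closure with the set {v | v ≠ x}: a₂ ≠ x and closed under c-adjacency
            have hne : a₂ ≠ x := fun h => hum (h ▸ mem_marks.2 (Or.inr (Or.inl rfl)))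
            have := mem_of_conn_of_closed (S := {v | v ≠ x})
              (fun v hv v' hvv' h' => hv (by subst h'; exact absurd (hvv'.symm) (fun hh => hiso _ hh))) hne hxc
            exact this rfl
          · exact absurd (hxo ▸ mem_marks.2 (Or.inr (Or.inr (Or.inr rfl)))) hum
          · -- x ∈ T: its open edges go to a₂ or o
            have huT : Conn ends y a₂ x := by
              rcases hf2 with h | h
              · exact conn_of_openAdj ⟨f, hyf, by
                  obtain ⟨v, hv⟩ := Sym2.mem_iff_exists.1 huf
                  rw [hv] at h ⊢
                  rcases Sym2.mem_iff.1 h with h' | h'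
                  · exact absurd (h'.symm ▸ mem_marks.2 (Or.inr (Or.inl rfl))) hum
                  · rw [h', Sym2.eq_swap]⟩
              · exact conn_trans hs.ho (conn_of_openAdj ⟨f, hyf, by
                  rw [ends_eq_of_unmarked_o ends a₁ a₂ b o hum huf h, Sym2.eq_swap]⟩)
            rcases src_open_edges_of_mem_T ends a₁ a₂ b o F hcls hs hum huT hye hxe with h | h
            · rw [hends] at h
              rcases Sym2.mem_iff.1 h with h' | h'
              · exact absurd (h'.symm ▸ mem_marks.2 (Or.inr (Or.inl rfl))) hum
              · exact h' ▸ ha₂Z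
            · rw [hends] at h
              rcases Sym2.mem_iff.1 h with h' | h'
              · exact absurd (h'.symm ▸ mem_marks.2 (Or.inr (Or.inr (Or.inr rfl)))) hum
              · exact Or.inr (Or.inl h'.symm)
          · -- x flipped with an open edge to b (and b ∈ T″): its open edges are to b only
            -- (an open edge to a₁ is excluded by the single-edge sharing, to a₂/o by S ∩ T = ∅)
            have huS : Conn ends y a₁ x := conn_trans hs.hb (conn_of_openAdj ⟨f, hyf, by
              obtain ⟨v, hv⟩ := Sym2.mem_iff_exists.1 huf
              rw [hv] at hbf ⊢
              rcases Sym2.mem_iff.1 hbf with h' | h'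
              · exact absurd (h'.symm ▸ mem_marks.2 (Or.inr (Or.inr (Or.inl rfl)))) hum
              · rw [h', Sym2.eq_swap]⟩)
            have hwm : w ∈ marks a₁ a₂ b o := (hcls e x hxe hum).1 w hwe (Ne.symm hxw)
            have hwS : Conn ends y a₁ w := conn_trans huS (conn_of_openAdj ⟨e, hye, hends⟩)
            rcases src_mark_mem_S ends a₁ a₂ b o F hs hwS hwm with h | h
            · -- w = a₁: then x has open edges to a₁ and b, contradicting that x is flipped
              subst w
              exact absurd hsh (src_not_shares_of_a1_b ends a₁ a₂ b o F hF hcls hs hum hyf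
                (by obtain ⟨v, hv⟩ := Sym2.mem_iff_exists.1 huf
                    rw [hv] at hbf ⊢
                    rcases Sym2.mem_iff.1 hbf with h' | h'
                    · exact absurd (h'.symm ▸ mem_marks.2 (Or.inr (Or.inr (Or.inl rfl)))) hum
                    · rw [h']) hye hends)
            · subst w
              exact Or.inl hbc
          · exact absurd hsh hns
    · -- y-closed unflipped edge: both ends unflipped (or marks), the edge is open in c
      have hce : c e = true := (cuf_eq_true_iff ends a₁ a₂ b o F y).2
        ⟨hnf, by unfold flipOn; rw [if_pos (hF e), hye]; rfl⟩
      rcases hx with hxc | hxo | ⟨hxm, hsh, -⟩ | ⟨hxm, hsh, -⟩ | ⟨hxm, hns, g, hyg, hg⟩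
      · exact Or.inl (conn_trans hxc (conn_of_openAdj ⟨e, hce, hends⟩))
      · -- x = o: the closed edge e at o is not mark–mark (flipped), so w is an unflipped
        -- unmarked vertex with a closed edge to o
        subst x
        have hwm : w ∉ marks a₁ a₂ b o := by
          intro hwm
          apply hnf; left
          refine ⟨hxe, fun v hv => ?_⟩
          rw [hends] at hv
          rcases Sym2.mem_iff.1 hv with h | h
          · exact h ▸ mem_marks.2 (Or.inr (Or.inr (Or.inr rfl)))
          · exact h ▸ hwm
        have hwns : ¬ sharesColourAtO ends o y w := fun h => hnf (Or.inr ⟨w, hwe, hwm, h⟩)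
        exact Or.inr (Or.inr (Or.inr (Or.inr ⟨hwm, hwns, e, hye, by rw [hends, Sym2.eq_swap]⟩)))
      · exact absurd hsh (fun h => hnf (Or.inr ⟨x, hxe, hxm, h⟩))
      · exact absurd hsh (fun h => hnf (Or.inr ⟨x, hxe, hxm, h⟩))
      · -- x an unflipped pendant at o: its closed edges all go to o
        -- the closed edge e at x: its other end w is a mark; w = o gives o ∈ Z; otherwise x would
        -- be flipped (two closed edges at x, one to o)
        have hwm : w ∈ marks a₁ a₂ b o := (hcls e x hxe hxm).1 w hwe (Ne.symm hxw)
        by_cases hwo : w = o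
        · exact Or.inr (Or.inl hwo)
        · exfalso; apply hns
          refine ⟨g, by rw [hg]; simp, by rw [hg]; simp, e, hxe, ?_, by rw [hye, hyg]⟩
          intro h; subst h
          rw [hends] at hg
          have : w ∈ s(x, o) := by rw [← hg]; simp
          rcases Sym2.mem_iff.1 this with h' | h'
          · exact hxw h'.symm
          · exact hwo h'
  have := mem_of_conn_of_closed hclosed ha₂Z (conn_symm hcon)
  exact ha₁Z this

end Clusters

end TypedBHKIndep

end Summit.Ventures.PercRepro2
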